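import Mathlib
import Literature.Analysis.FluidPDE.BallRadialMoments
import Summits.NavierStokesRegularity.NavierStokesRegularity.Theorems.EulerZoomLiouvillePowerGaugeEulerLiouvilleRadialVirial

/-!
# R49 plate t52-BM: BALL FIRST MOMENTS (nsreg-p2 ROUND-49 «EVERY BALL BREATHES», `NsregP2.R49.BallFirstMoments`, text from
`r49/Sketch49.lean` l.90–97 with the local abbreviation `transportW γ c V y = γ • (y − c) + V y` UNFOLDED; seat ns-ezl-w2 g5,
`--supports stmt-NavierStokesRegularity-19832 --as helper`)

For a `γ`-profile `(V, P)`, every centre `x₀` and radius `δ > 0`: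
`∫_{B_δ(x₀)} ⟪V, y − x₀⟫ dy = 0` and `∫_{B_δ(x₀)} ⟪γ(y − c) + V, y − x₀⟫ dy = (4π/5)·γ·δ⁵`.
Proof: for every `C¹` divergence-free `U`, `∫_{B_δ(x₀)} ⟪U, y − x₀⟫ = 0` (`integral_ball_inner_sub_eq_zero`): smooth radial cutoffs
`ψ_n(‖z‖²)` (bump functions in the variable `‖z‖²`, `= 1` on `[0, δ²(1 − 1/(n+2))]`, `= 0` beyond `δ²`) are gradients of `C²_c` test
functions (`exists_radial_test`, t52-RV), so each cutoff integral vanishes (`integral_inner_gradient_eq_zero`), and dominated convergence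
passes to the sharp ball; then `γ(y − c) + V = γ(y − x₀) + (γ(x₀ − c) + V)` and `∫_{B_δ}‖z‖² = 4πδ⁵/5` (`integral_ball_radial_mul_norm_sq`).

HONEST FRAMING: class-free bookkeeping (a ROUND-49 instrument statement); nothing about the crux E (19832 OPEN) or NS regularity.
[nsreg-p2 R49 §1.2; folklore]
-/

noncomputable section

set_option linter.dupNamespace false

open MeasureTheory Set Filter Topology Metric Function TopologicalSpace
open scoped ENNReal NNReal RealInnerProductSpace ContDiff

namespace Summit.NavierStokesRegularity.NavierStokesRegularity.Theorems.PowerGaugeEulerLiouville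

open Literature.Analysis Literature.Analysis.FunctionSpaces Literature.Analysis.FluidPDE

namespace ClassicalProfile

/-- **First moment of a divergence-free field on a ball**: `∫_{B_δ(x₀)} ⟪U, y − x₀⟫ dy = 0` for `U ∈ C¹` divergence free (`0 < δ`).
[folklore] -/
theorem integral_ball_inner_sub_eq_zero {U : EuclideanSpace ℝ (Fin 3) → EuclideanSpace ℝ (Fin 3)} (hU : ContDiff ℝ 1 U)
    (hdiv : VectorCalculus.IsDivFree U) (x₀ : EuclideanSpace ℝ (Fin 3)) {δ : ℝ} (hδ : 0 < δ) :
    ∫ y in ball x₀ δ, ⟪U y, y - x₀⟫ = 0 := by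
  have hδ2 : 0 < δ ^ 2 := by positivity
  -- the cutoffs `ψ_n`: bump functions of the variable `s = ‖z‖²`, `= 1` on `[0, δ²(1 − 1/(n+2))]`, `= 0` beyond `δ²`
  have hr : ∀ n : ℕ, 0 < δ ^ 2 * (1 - 1 / ((n : ℝ) + 2)) ∧ δ ^ 2 * (1 - 1 / ((n : ℝ) + 2)) < δ ^ 2 := by
    intro n
    have h2 : (0 : ℝ) < (n : ℝ) + 2 := by positivity
    have h3 : 1 / ((n : ℝ) + 2) < 1 := by rw [div_lt_one h2]; linarith
    have h4 : 0 < 1 / ((n : ℝ) + 2) := by positivity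
    exact ⟨by nlinarith, by nlinarith⟩
  let b : ℕ → ContDiffBump (0 : ℝ) := fun n => ⟨δ ^ 2 * (1 - 1 / ((n : ℝ) + 2)), δ ^ 2, (hr n).1, (hr n).2⟩
  -- each cutoff integral vanishes
  have hzero : ∀ n, ∫ y, (b n) (‖y - x₀‖ ^ 2) * ⟪U y, y - x₀⟫ = 0 := by
    intro n
    obtain ⟨X, hX, hXc, hgrad⟩ := exists_radial_test ((b n).contDiff (n := 1)) (b n).hasCompactSupport x₀
    have h := integral_inner_gradient_eq_zero hU hdiv (hX.of_le (by norm_cast)) hXc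
    refine (integral_congr_ae (ae_of_all _ fun y => ?_)).trans h
    show (b n) (‖y - x₀‖ ^ 2) * ⟪U y, y - x₀⟫ = ⟪U y, gradient X y⟫
    rw [(hgrad y).gradient, real_inner_smul_right]
  -- dominated convergence to the sharp ball
  have hcontF : ∀ n, Continuous fun y : EuclideanSpace ℝ (Fin 3) => (b n) (‖y - x₀‖ ^ 2) * ⟪U y, y - x₀⟫ := fun n =>
    ((b n).continuous.comp ((continuous_id.sub continuous_const).norm.pow 2)).mul
      (hU.continuous.inner (continuous_id.sub continuous_const))
  have hcontG : Continuous fun y : EuclideanSpace ℝ (Fin 3) => ‖U y‖ * ‖y - x₀‖ :=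
    hU.continuous.norm.mul (continuous_id.sub continuous_const).norm
  have hlim := tendsto_integral_of_dominated_convergence (μ := volume)
    (F := fun n y => (b n) (‖y - x₀‖ ^ 2) * ⟪U y, y - x₀⟫)
    (f := (ball x₀ δ).indicator fun y => ⟪U y, y - x₀⟫)
    ((closedBall x₀ δ).indicator fun y => ‖U y‖ * ‖y - x₀‖)
    (fun n => (hcontF n).aestronglyMeasurable)
    (((hcontG.continuousOn).integrableOn_compact (isCompact_closedBall x₀ δ)).integrable_indicator measurableSet_closedBall)
    (fun n => ae_of_all _ fun y => by
      by_cases hy : y ∈ closedBall x₀ δ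
      · rw [indicator_of_mem hy, Real.norm_eq_abs, abs_mul]
        exact mul_le_mul (by rw [abs_of_nonneg (b n).nonneg]; exact (b n).le_one) (abs_real_inner_le_norm _ _)
          (abs_nonneg _) zero_le_one |>.trans (by rw [one_mul])
      · have hψ : (b n) (‖y - x₀‖ ^ 2) = 0 := by
          apply (b n).zero_of_le_dist
          rw [mem_closedBall, dist_eq_norm, not_le] at hy
          show δ ^ 2 ≤ dist (‖y - x₀‖ ^ 2) 0
          rw [dist_zero_right, Real.norm_eq_abs, abs_of_nonneg (by positivity)]
          nlinarith [norm_nonneg (y - x₀)]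
        rw [indicator_of_notMem hy, hψ, zero_mul, norm_zero])
    (ae_of_all _ fun y => by
      by_cases hy : y ∈ ball x₀ δ
      · rw [indicator_of_mem hy]
        -- eventually the cutoff is `1` at `y`
        have hq : ‖y - x₀‖ ^ 2 < δ ^ 2 := by
          rw [mem_ball, dist_eq_norm] at hy
          nlinarith [norm_nonneg (y - x₀)]
        obtain ⟨N, hN⟩ := exists_nat_ge (δ ^ 2 / (δ ^ 2 - ‖y - x₀‖ ^ 2))
        refine tendsto_const_nhds.congr' ?_
        filter_upwards [Filter.eventually_ge_atTop N] with n hn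
        have hn' : (N : ℝ) ≤ n := by exact_mod_cast hn
        have hmem : ‖y - x₀‖ ^ 2 ∈ closedBall (0 : ℝ) (b n).rIn := by
          rw [mem_closedBall, dist_zero_right, Real.norm_eq_abs, abs_of_nonneg (by positivity)]
          show ‖y - x₀‖ ^ 2 ≤ δ ^ 2 * (1 - 1 / ((n : ℝ) + 2))
          have hpos : 0 < δ ^ 2 - ‖y - x₀‖ ^ 2 := by linarith
          have h1 : δ ^ 2 / (δ ^ 2 - ‖y - x₀‖ ^ 2) ≤ (n : ℝ) + 2 := by linarith
          rw [div_le_iff₀ hpos] at h1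
          have h2 : δ ^ 2 * (1 - 1 / ((n : ℝ) + 2)) = δ ^ 2 - δ ^ 2 / ((n : ℝ) + 2) := by ring
          rw [h2, le_sub_comm, div_le_iff₀ (by positivity : (0 : ℝ) < (n : ℝ) + 2)]
          linarith
        show ⟪U y, y - x₀⟫ = (b n) (‖y - x₀‖ ^ 2) * ⟪U y, y - x₀⟫
        rw [(b n).one_of_mem_closedBall hmem, one_mul]
      · rw [indicator_of_notMem hy]
        have hψ : ∀ n, (b n) (‖y - x₀‖ ^ 2) = 0 := by
          intro n
          apply (b n).zero_of_le_dist
          rw [mem_ball, dist_eq_norm, not_lt] at hy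
          show δ ^ 2 ≤ dist (‖y - x₀‖ ^ 2) 0
          rw [dist_zero_right, Real.norm_eq_abs, abs_of_nonneg (by positivity)]
          nlinarith [norm_nonneg (y - x₀)]
        simp only [hψ, zero_mul]
        exact tendsto_const_nhds)
  simp only [hzero] at hlim
  have h0 := tendsto_nhds_unique hlim tendsto_const_nhds
  rw [integral_indicator measurableSet_ball] at h0
  exact h0

/-- `∫_{B_δ(x₀)} ‖y − x₀‖² dy = 4πδ⁵/5`. [folklore] -/
theorem integral_ball_norm_sub_sq (x₀ : EuclideanSpace ℝ (Fin 3)) {δ : ℝ} (hδ : 0 < δ) :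
    ∫ y in ball x₀ δ, ‖y - x₀‖ ^ 2 = 4 * Real.pi / 5 * δ ^ 5 := by
  have htrans : ∫ y in ball x₀ δ, ‖y - x₀‖ ^ 2 = ∫ p in ball (0 : EuclideanSpace ℝ (Fin 3)) δ, ‖p‖ ^ 2 := by
    rw [← integral_indicator measurableSet_ball, ← integral_indicator measurableSet_ball,
      ← integral_sub_right_eq_self (fun p : EuclideanSpace ℝ (Fin 3) => (ball (0 : EuclideanSpace ℝ (Fin 3)) δ).indicator
        (fun p => ‖p‖ ^ 2) p) x₀]
    refine integral_congr_ae (ae_of_all _ fun y => ?_)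
    show (ball x₀ δ).indicator (fun y => ‖y - x₀‖ ^ 2) y =
      (ball (0 : EuclideanSpace ℝ (Fin 3)) δ).indicator (fun p => ‖p‖ ^ 2) (y - x₀)
    by_cases hy : y ∈ ball x₀ δ
    · have hy' : y - x₀ ∈ ball (0 : EuclideanSpace ℝ (Fin 3)) δ := by
        rwa [mem_ball, dist_zero_right, ← dist_eq_norm, ← mem_ball]
      rw [indicator_of_mem hy, indicator_of_mem hy']
    · have hy' : y - x₀ ∉ ball (0 : EuclideanSpace ℝ (Fin 3)) δ := by
        rwa [mem_ball, dist_zero_right, ← dist_eq_norm, ← mem_ball]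
      rw [indicator_of_notMem hy, indicator_of_notMem hy']
  rw [htrans]
  have h := integral_ball_radial_mul_norm_sq (fun _ => (1 : ℝ)) hδ.le
  simp only [one_mul, mul_one] at h
  rw [h, integral_pow]
  ring

/-- **BALL FIRST MOMENTS** (`NsregP2.R49.BallFirstMoments γ` with `transportW` unfolded): for a `γ`-profile `(V, P)` with centre `c`,
every `x₀` and `δ > 0`, `∫_{B_δ(x₀)} ⟪V, y − x₀⟫ = 0` and `∫_{B_δ(x₀)} ⟪γ(y − c) + V, y − x₀⟫ = (4π/5)γδ⁵`. [nsreg-p2 R49 §1.2; folklore] -/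
theorem ballFirstMoments (γ : ℝ) :
    ∀ (c : EuclideanSpace ℝ (Fin 3)) (V : EuclideanSpace ℝ (Fin 3) → EuclideanSpace ℝ (Fin 3)) (P : EuclideanSpace ℝ (Fin 3) → ℝ),
      IsSelfSimilarEulerProfile γ c V P →
      ∀ (x₀ : EuclideanSpace ℝ (Fin 3)) (δ : ℝ), 0 < δ →
        (∫ y in ball x₀ δ, ⟪V y, y - x₀⟫ = 0)
        ∧ (∫ y in ball x₀ δ, ⟪γ • (y - c) + V y, y - x₀⟫ = 4 * Real.pi / 5 * γ * δ ^ 5) := by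
  intro c V P hprof x₀ δ hδ
  have hV1 : ContDiff ℝ 1 V := hprof.contDiff_velocity.of_le (by norm_cast)
  refine ⟨integral_ball_inner_sub_eq_zero hV1 hprof.divFree x₀ hδ, ?_⟩
  -- `γ(y − c) + V = γ(y − x₀) + U'`, `U' = γ(x₀ − c) + V` divergence free
  have hU' : ContDiff ℝ 1 (fun y => γ • (x₀ - c) + V y) := contDiff_const.add hV1
  have hdivU' : VectorCalculus.IsDivFree (fun y => γ • (x₀ - c) + V y) := by
    intro y
    have hadd : fderiv ℝ (fun y => γ • (x₀ - c) + V y) y = fderiv ℝ V y :=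
      fderiv_const_add (γ • (x₀ - c))
    have h0 := hprof.divFree y
    unfold VectorCalculus.divergence at h0 ⊢
    rw [hadd]
    exact h0
  have h1 := integral_ball_inner_sub_eq_zero hU' hdivU' x₀ hδ
  have h2 := integral_ball_norm_sub_sq x₀ hδ
  have hpt : ∀ y, ⟪γ • (y - c) + V y, y - x₀⟫ = γ * ‖y - x₀‖ ^ 2 + ⟪γ • (x₀ - c) + V y, y - x₀⟫ := by
    intro y
    rw [show γ • (y - c) + V y = γ • (y - x₀) + (γ • (x₀ - c) + V y) by
      rw [← add_assoc, ← smul_add, sub_add_sub_cancel], inner_add_left, real_inner_smul_left, real_inner_self_eq_norm_sq]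
  have hi1 : IntegrableOn (fun y => γ * ‖y - x₀‖ ^ 2) (ball x₀ δ) :=
    ((continuous_const.mul ((continuous_id.sub continuous_const).norm.pow 2)).continuousOn.integrableOn_compact
      (isCompact_closedBall x₀ δ)).mono_set ball_subset_closedBall
  have hi2 : IntegrableOn (fun y => ⟪γ • (x₀ - c) + V y, y - x₀⟫) (ball x₀ δ) :=
    ((hU'.continuous.inner (continuous_id.sub continuous_const)).continuousOn.integrableOn_compact
      (isCompact_closedBall x₀ δ)).mono_set ball_subset_closedBall
  rw [setIntegral_congr_fun measurableSet_ball fun y _ => hpt y, integral_add hi1 hi2, h1, add_zero, integral_const_mul, h2]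
  ring

end ClassicalProfile

end Summit.NavierStokesRegularity.NavierStokesRegularity.Theorems.PowerGaugeEulerLiouville

end
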